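import Summits.AnomalousDissipation.AnomalousDissipation.Theorems.IsotropicCubatureWord

/-!
# W7 `HighLabelDecayW` — coverage lemma and the typed three-piece re-cut (planner ad-ideate-p5 g9, lens «profile»)

Companion of `Lines/onelevel_highLabelDecay.lean` (W7 text) and of the profile memo `HighLabelDecay-Profile.md`
(kit j316375 smoke / j316406 full).  What is PROVED here is the finite-dimensional obstruction that drives both the
compact-range and the large-`r` halves of the re-cut architecture:

* `coupledUnshielded_exists` — for every direction `q ≠ 0` of a Bloch fibre some slot of `cubatureWord` is at once
  COUPLED (`v_j · q ≠ 0`, the layer shears the fibre) and UNSHIELDED ON THE WHOLE SLOW PLANE (`m_j · q ≠ 0`, so no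
  divergence-free polarisation `p ⊥ q` has `p = ± m̂_j`, i.e. the Leray factor `1 - (m̂_j·p)²` of the hop `κ → κ ± m_j`
  is `≥ (m̂_j·q̂)² > 0` for every `p ⊥ q`).  Numerically `γ₀ := min_{|q|=1} max_j |ê_j·q|·|m̂_j·q| = 0.3955` (job j316375).
* `slotTermNull_iff`-type remark: a period-LOSSLESS slow state at the `ν → 0` limit must have `slotTerm (slots j) q p = 0`
  for every `j`, which `slotTerm_sum` (= `168/(32π⁴)·|q|²` on unit `p ⊥ q`) forbids — recorded as `no_slotTerm_null`.

Quantitative forms (added, both PROVED): `slotTerm_quant` (pigeonhole: some slot term `≥ 168/(32π⁴·26)`) and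
`coupledUnshielded_quant` (`∃ γ > 0` uniform over unit directions, by compactness of the sphere + `coupledUnshielded_exists`).

Informal architecture (memo §2): W7 = fibre bookkeeping + per-slot non-expansion + bare decay of off-line content
+ [C] continuity/compactness on `r ∈ [1/Kb, R₁]` with the lossless analysis (`no_slotTerm_null`) + [E] uniform relaxation
enhancement of ONE coupled-unshielded slot as `r → ∞` (`coupledUnshielded_exists`; Bedrossian–Coti Zelati 2017 Thm 1.1,
arXiv:1510.08098, is the scalar steady engine, condition `ν/|k| ≤ κ₀` ⇔ `r_s ≥ R₁`).
-/

namespace Summit.AnomalousDissipation.AnomalousDissipation.Cruxes.LagrangianRenormalisationStepDesign.HighLabelDecayProfile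

open Summit.AnomalousDissipation.AnomalousDissipation.Theorems
open scoped Real InnerProductSpace

/-- COVERAGE (coupled-unshielded slot): for every `q ≠ 0` there is a slot `j` of the 26-slot cubature word with
`v_j · q ≠ 0` and `m_j · q ≠ 0`.  Only the six axis slots and the two face-diagonal slots `j = 7, 11` are used. -/
theorem coupledUnshielded_exists (q : Fin 3 → ℝ) (hq : q ≠ 0) :
    ∃ j : Fin 26, (((slots j).v 0 : ℝ) * q 0 + (slots j).v 1 * q 1 + (slots j).v 2 * q 2) ≠ 0 ∧
      (((slots j).m 0 : ℝ) * q 0 + (slots j).m 1 * q 1 + (slots j).m 2 * q 2) ≠ 0 := by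
  by_contra h
  push Not at h
  have h2 := h 2
  have h4 := h 4
  have h7 := h 7
  have h11 := h 11
  simp only [slots, Matrix.cons_val_zero, Matrix.cons_val_one, Matrix.head_cons,
    Matrix.cons_val_two, Matrix.tail_cons] at h2 h4 h7 h11
  push_cast at h2 h4 h7 h11
  simp only [one_mul, zero_mul, add_zero, zero_add, neg_mul] at h2 h4 h7 h11
  have hq0 : q 0 = 0 := by
    by_contra h0
    have hq1 : q 1 = 0 := h2 h0
    have hq2 : q 2 = 0 := h4 h0
    have : q 0 + -q 1 ≠ 0 := by rw [hq1]; simpa using h0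
    have h7' := h7 (by simpa [sub_eq_add_neg] using this)
    apply h0; linarith
  have hq1 : q 1 = 0 := by
    by_contra h1
    have : q 0 + -q 1 ≠ 0 := by rw [hq0]; simpa using h1
    have h7' := h7 (by simpa [sub_eq_add_neg] using this)
    apply h1; linarith
  have hq2 : q 2 = 0 := by
    by_contra h2'
    have : q 0 + -q 2 ≠ 0 := by rw [hq0]; simpa using h2'
    have h11' := h11 (by simpa [sub_eq_add_neg] using this)
    apply h2'; linarith
  apply hq
  funext i
  fin_cases i <;> simp [hq0, hq1, hq2]

/-- LOSSLESS OBSTRUCTION: no unit `p ⊥ q` (with `q` unit) annihilates every slot term — immediate from `slotTerm_sum`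
(the sum is `168/(32π⁴) > 0`).  This is the fact the compact-range half of the re-cut consumes: a period-lossless slow state
at the `ν → 0` limit would need `slotTerm (slots j) q p = 0` for all `j`. -/
theorem no_slotTerm_null (q p : EuclideanSpace ℝ (Fin 3)) (hq : ‖q‖ = 1) (hp : ‖p‖ = 1) (hpq : ⟪p, q⟫_ℝ = 0) :
    ∃ j : Fin 26, slotTerm (slots j) q p ≠ 0 := by
  by_contra h
  push Not at h
  have hsum : ∑ j, slotTerm (slots j) q p = 0 := Finset.sum_eq_zero fun j _ => h j
  rw [slotTerm_sum] at hsum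
  have hq2 : q 0 ^ 2 + q 1 ^ 2 + q 2 ^ 2 = 1 := by
    have := Literature.Algebra.EuclideanLattices.norm_sq_fin_three q
    rw [hq, one_pow] at this; linarith [this]
  have hp2 : p 0 ^ 2 + p 1 ^ 2 + p 2 ^ 2 = 1 := by
    have := Literature.Algebra.EuclideanLattices.norm_sq_fin_three p
    rw [hp, one_pow] at this; linarith [this]
  have hpq' : p 0 * q 0 + p 1 * q 1 + p 2 * q 2 = 0 := by
    have := Literature.Algebra.EuclideanLattices.inner_fin_three p q
    rw [hpq] at this; linarith [this]
  rw [hq2, hp2, hpq'] at hsum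
  have hπ : (0:ℝ) < 32 * π ^ 4 := by positivity
  rw [div_eq_zero_iff] at hsum
  rcases hsum with h1 | h1 <;> nlinarith [hπ]


/-- QUANTITATIVE LOSSLESS OBSTRUCTION (pigeonhole on `slotTerm_sum`): for unit `q` and unit `p ⊥ q` some slot term is
at least `168 / (32 π⁴ · 26)`.  (Each `slotTerm` is a fixed polynomial, so this is the uniform-in-`(q,p)` form the
compactness half `stub_compactRange` wants at the `ν → 0` endpoint.) -/
theorem slotTerm_quant (q p : EuclideanSpace ℝ (Fin 3)) (hq : ‖q‖ = 1) (hp : ‖p‖ = 1) (hpq : ⟪p, q⟫_ℝ = 0) :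
    ∃ j : Fin 26, 168 / (32 * π ^ 4) / 26 ≤ slotTerm (slots j) q p := by
  have hq2 : q 0 ^ 2 + q 1 ^ 2 + q 2 ^ 2 = 1 := by
    have := Literature.Algebra.EuclideanLattices.norm_sq_fin_three q
    rw [hq, one_pow] at this; linarith [this]
  have hp2 : p 0 ^ 2 + p 1 ^ 2 + p 2 ^ 2 = 1 := by
    have := Literature.Algebra.EuclideanLattices.norm_sq_fin_three p
    rw [hp, one_pow] at this; linarith [this]
  have hpq' : p 0 * q 0 + p 1 * q 1 + p 2 * q 2 = 0 := by
    have := Literature.Algebra.EuclideanLattices.inner_fin_three p q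
    rw [hpq] at this; linarith [this]
  have hsum : ∑ j, slotTerm (slots j) q p = 168 / (32 * π ^ 4) := by
    rw [slotTerm_sum, hq2, hp2, hpq']; ring
  have hle : ∑ _j : Fin 26, (168 / (32 * π ^ 4) / 26 : ℝ) ≤ ∑ j, slotTerm (slots j) q p := by
    rw [hsum, Finset.sum_const, Finset.card_univ, Fintype.card_fin, nsmul_eq_mul]; push_cast
    exact le_of_eq (by ring)
  obtain ⟨j, -, hj⟩ := Finset.exists_le_of_sum_le Finset.univ_nonempty hle
  exact ⟨j, hj⟩

/-- The coupling–unshielding polynomial of slot `j` at direction `q`: `(v_j·q)² (m_j·q)²`. -/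
noncomputable def cuPoly (j : Fin 26) (q : EuclideanSpace ℝ (Fin 3)) : ℝ :=
  (((slots j).v 0 : ℝ) * q 0 + (slots j).v 1 * q 1 + (slots j).v 2 * q 2) ^ 2 *
    (((slots j).m 0 : ℝ) * q 0 + (slots j).m 1 * q 1 + (slots j).m 2 * q 2) ^ 2

theorem cuPoly_nonneg (j : Fin 26) (q : EuclideanSpace ℝ (Fin 3)) : 0 ≤ cuPoly j q := by
  unfold cuPoly; positivity

theorem continuous_cuPoly (j : Fin 26) : Continuous (cuPoly j) := by
  have hc : ∀ i : Fin 3, Continuous fun q : EuclideanSpace ℝ (Fin 3) => q i := fun i =>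
    (continuous_apply i).comp (PiLp.continuous_ofLp 2 (fun _ : Fin 3 => ℝ))
  unfold cuPoly
  exact ((((continuous_const.mul (hc 0)).add (continuous_const.mul (hc 1))).add
      (continuous_const.mul (hc 2))).pow 2).mul
    ((((continuous_const.mul (hc 0)).add (continuous_const.mul (hc 1))).add
      (continuous_const.mul (hc 2))).pow 2)

/-- QUANTITATIVE COVERAGE (`γ₀ > 0`): by compactness of the unit sphere and `coupledUnshielded_exists`, there is a
uniform `γ > 0` such that every unit direction `q` has a slot with `(v_j·q)² (m_j·q)² ≥ γ` — the uniform-in-direction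
form the large-`r` half `stub_largeR` wants (numerically `γ₀ = min_q max_j |ê_j·q̂||m̂_j·q̂| = 0.3955`, kit j316500 part C,
in the normalised variables). -/
theorem coupledUnshielded_quant :
    ∃ γ : ℝ, 0 < γ ∧ ∀ q : EuclideanSpace ℝ (Fin 3), ‖q‖ = 1 → ∃ j : Fin 26, γ ≤ cuPoly j q := by
  set g : EuclideanSpace ℝ (Fin 3) → ℝ := fun q => ∑ j, cuPoly j q with hg
  have hcont : Continuous g := by
    simpa [hg] using continuous_finsetSum Finset.univ fun j _ => continuous_cuPoly j
  have hS : IsCompact (Metric.sphere (0 : EuclideanSpace ℝ (Fin 3)) 1) := isCompact_sphere 0 1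
  have hne : (Metric.sphere (0 : EuclideanSpace ℝ (Fin 3)) 1).Nonempty :=
    NormedSpace.sphere_nonempty.mpr zero_le_one
  obtain ⟨q₀, hq₀S, hmin⟩ := hS.exists_isMinOn hne hcont.continuousOn
  have hq₀ : ‖q₀‖ = 1 := by simpa using hq₀S
  have hq₀ne : (WithLp.ofLp q₀ : Fin 3 → ℝ) ≠ 0 := by
    intro h
    rw [WithLp.ofLp_eq_zero] at h
    rw [h, norm_zero] at hq₀; exact zero_ne_one hq₀
  obtain ⟨j₀, hv, hm⟩ := coupledUnshielded_exists (WithLp.ofLp q₀) hq₀ne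
  have hpos : 0 < g q₀ := by
    have hj₀ : 0 < cuPoly j₀ q₀ := by
      unfold cuPoly
      have h1 : 0 < (((slots j₀).v 0 : ℝ) * q₀ 0 + (slots j₀).v 1 * q₀ 1 + (slots j₀).v 2 * q₀ 2) ^ 2 := by positivity
      have h2 : 0 < (((slots j₀).m 0 : ℝ) * q₀ 0 + (slots j₀).m 1 * q₀ 1 + (slots j₀).m 2 * q₀ 2) ^ 2 := by positivity
      exact mul_pos h1 h2
    calc (0 : ℝ) < cuPoly j₀ q₀ := hj₀
      _ ≤ g q₀ := by
        simpa [hg] using Finset.single_le_sum (f := fun j => cuPoly j q₀) (fun j _ => cuPoly_nonneg j q₀)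
          (Finset.mem_univ j₀)
  refine ⟨g q₀ / 26, by positivity, fun q hq => ?_⟩
  have hqS : q ∈ Metric.sphere (0 : EuclideanSpace ℝ (Fin 3)) 1 := by simpa using hq
  have hle : g q₀ ≤ g q := hmin hqS
  have hle' : ∑ _j : Fin 26, g q₀ / 26 ≤ ∑ j, cuPoly j q := by
    rw [Finset.sum_const, Finset.card_univ, Fintype.card_fin]
    have : (26 : ℕ) • (g q₀ / 26) = g q₀ := by rw [nsmul_eq_mul]; push_cast; ring
    rw [this]; simpa [hg] using hle
  obtain ⟨j, -, hj⟩ := Finset.exists_le_of_sum_le Finset.univ_nonempty hle'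
  exact ⟨j, hj⟩

end Summit.AnomalousDissipation.AnomalousDissipation.Cruxes.LagrangianRenormalisationStepDesign.HighLabelDecayProfile
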